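import Literature.NumberTheory.Automorphic.ArchLocalRegularCentralizer          -- ★ (V2-alg): `centralizer_circleDiagonal_eq_subgroupOf`, `centralizer_circleDiagonal_mul_comm`
import Literature.NumberTheory.Automorphic.TorusNormalisedCentralizerMeasures   -- ★ (V2-meas, generic): `exists_isQuotientOf_of_torusHaar`
import Literature.NumberTheory.Automorphic.ArchLocalRegularOrbitClosed          -- ★ `UnitaryGroup.locallyCompactSpace_archLocal`, `secondCountableTopology_archLocal`
import HarnessLib

/-!
# The torus-normalised orbital-measure family of `G_w = U(σ_w diag α)(ℂ)` along its circle torus (road D1′ ∕ «D2′a», (V2) per place; Rogawski 1990 §1.7, §4.3, §8.2)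

Topic `NumberTheory/Automorphic`; namespace `Literature.NumberTheory.Automorphic.UnitaryGroup`.  THEOREMS ONLY (no definition, no named fact, no instance, no
notation, no `sorry`).  Cell `hodgecm-mathlib`, floor-1 prep under #88 (ST-∞) ∕ #111 (S-d): the per-place INSTANTIATION of ★ `exists_isQuotientOf_of_torusHaar`
(CENSUS-D2prime-HClimit §4 (V2); LEAD T6-84 (V7) «per place», T6-87): for the complex place `w` of the CM field `L`, the group `G_w = U(σ_w diag α)(ℂ)`
(★ `archLocal L N (diagonal α) w`, `α` non-degenerate diagonal hermitian, any signature, any `N`), its circle torus `T_w = range (circleDiagonal N) ∩ G_w`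
(★ D1′b `circleDiagonal`; as a subgroup of `G_w`: `(circleDiagonal N).range.subgroupOf …`), ONE Haar measure `t_T` on `T_w` and a right-invariant measure `ν`
on `G_w`: there are centraliser measures `t` — EQUAL TO `t_T` TRANSPORTED along ★ `Z_{G_w}(γ_z) = T_w` at every REGULAR torus point `γ_z = diag(z)` (`z`
injective) — and an orbital-measure family `m` in Weil form `dν ∕ dt_T` there (★ `OrbitalMeasureFamily.IsQuotientOf`).  This is the normalisation under which
`z ↦ D(γ_z)^{1∕2} Φ_{γ_z}(f)` (★ `archWeylDiscr`, ★ `orbitalIntegral`) is Harish-Chandra's function `F_f` on `T_reg`, the object of the limit formulas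
([Rogawski1990] §8.2 pp. 122–124).

* **`UnitaryGroup.exists_isQuotientOf_circleTorus`** (topology of `G_w` from ★ `locallyCompactSpace_archLocal` ∕ `secondCountableTopology_archLocal`) — the torus-normalised family at the regular circle-torus points of `U(σ_w diag α)(ℂ)`.

JUNK AUDIT: `hα : ∀ i, α i ≠ 0` is what makes `Z(γ_z) = T_w` (★ (V2-alg)); the binders `[LocallyCompactSpace] [SecondCountableTopology]` on `G_w` are what ★
`OrbitalMeasureFamily.IsQuotientOf` needs to be stated — dischargeable by ★ `locallyCompactSpace_archLocal` ∕ `secondCountableTopology_archLocal` (theorems, not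
instances, in the tree); `ν` right-invariant and finite on compacta as ★ `IsQuotientOf` demands (every Haar measure of the
reductive `G_w` qualifies — unimodularity is ★ elsewhere and not needed here); the quotient σ-algebras are section hypotheses (`borel` at use), as in ★
`ArchCentralizerHaarMeasures`.  The family is unspecified (`0`) off the regular torus classes — never read.
HONEST LABEL: HC_CM is proved only modulo the printed citations until rung 0 closes; this is count-neutral floor-1 preparation; the letters (L-H)∕(L-st) of the census
are untouched.

## References
* J. D. Rogawski, *Automorphic Representations of Unitary Groups in Three Variables*, Ann. of Math. Stud. 123 (1990), §1.7 p. 6, §4.3 (4.3.1) p. 43, §8.2 pp. 122–124 [Rogawski1990].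
* A. Deitmar, S. Echterhoff, *Principles of Harmonic Analysis*, 2nd ed. (2014), Thm. 1.5.3 [DeitmarEchterhoff2014].
-/

set_option autoImplicit false

noncomputable section

open MeasureTheory Measure NumberField NumberField.InfinitePlace
open scoped MatrixGroups

namespace Literature.NumberTheory.Automorphic

namespace UnitaryGroup

variable (L : Type) [Field L] [NumberField L] [IsCMField L] (N : ℕ) (α : Fin N → L) (w : {w : InfinitePlace L // IsComplex w})

omit [NumberField L] [IsCMField L] in
/-- **THE TORUS-NORMALISED ORBITAL-MEASURE FAMILY OF `U(σ_w diag α)(ℂ)`** (any `N`, any signature, `α_i ≠ 0`): for ONE Haar measure `t_T` on the circle torus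
`T_w ≤ G_w` and a right-invariant measure `ν` on `G_w` (finite on compacta) there are centraliser measures `t` with
`t γ_z = t_T.map (T_w = Z(γ_z))` at every regular torus point `γ_z = diag(z)` (`z` injective; ★ `centralizer_circleDiagonal_eq_subgroupOf`) and an orbital-measure
family `m` with ★ `OrbitalMeasureFamily.IsQuotientOf P ν t m`, `P γ := ∃ z, Injective z ∧ γ = γ_z` — Weil form `m ⟦γ_z⟧ = dν ∕ dt_T`; each `t γ_z` is an
inversion-invariant Haar measure of the (commutative) torus `Z(γ_z)`. [cite: Rogawski1990, §1.7 p. 6; §4.3 (4.3.1) p. 43; §8.2 p. 122] [cite: DeitmarEchterhoff2014, Thm. 1.5.3] -/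
theorem exists_isQuotientOf_circleTorus (hα : ∀ i, α i ≠ 0)
    [LocallyCompactSpace (archLocal L N (Matrix.diagonal α) w)] [SecondCountableTopology (archLocal L N (Matrix.diagonal α) w)]
    [MeasurableSpace (archLocal L N (Matrix.diagonal α) w)] [BorelSpace (archLocal L N (Matrix.diagonal α) w)]
    [∀ γ : archLocal L N (Matrix.diagonal α) w,
      MeasurableSpace (archLocal L N (Matrix.diagonal α) w ⧸ Subgroup.centralizer ({γ} : Set (archLocal L N (Matrix.diagonal α) w)))]
    [∀ γ : archLocal L N (Matrix.diagonal α) w,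
      BorelSpace (archLocal L N (Matrix.diagonal α) w ⧸ Subgroup.centralizer ({γ} : Set (archLocal L N (Matrix.diagonal α) w)))]
    (ν : Measure (archLocal L N (Matrix.diagonal α) w)) [IsFiniteMeasureOnCompacts ν] [ν.IsMulRightInvariant]
    (tT : Measure ↥((circleDiagonal N).range.subgroupOf (archLocal L N (Matrix.diagonal α) w))) [tT.IsHaarMeasure] :
    ∃ (t : ∀ γ : archLocal L N (Matrix.diagonal α) w,
          Measure (Subgroup.centralizer ({γ} : Set (archLocal L N (Matrix.diagonal α) w))))
      (m : OrbitalMeasureFamily (archLocal L N (Matrix.diagonal α) w)),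
      (∀ (z : Fin N → Circle) (hz : Function.Injective z),
        t ⟨circleDiagonal N z, circleDiagonal_mem_archLocal_diagonal L N α w z⟩ =
          tT.map (MulEquiv.subgroupCongr (centralizer_circleDiagonal_eq_subgroupOf L N α w hα hz).symm)) ∧
      m.IsQuotientOf
        (fun γ => ∃ z : Fin N → Circle, Function.Injective z ∧
          γ = ⟨circleDiagonal N z, circleDiagonal_mem_archLocal_diagonal L N α w z⟩) ν t := by
  -- `T_w = Z(γ)` and commutativity of `Z(γ)` at the regular torus points
  have hP : ∀ γ : archLocal L N (Matrix.diagonal α) w,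
      (∃ z : Fin N → Circle, Function.Injective z ∧ γ = ⟨circleDiagonal N z, circleDiagonal_mem_archLocal_diagonal L N α w z⟩) →
        (circleDiagonal N).range.subgroupOf (archLocal L N (Matrix.diagonal α) w) =
          Subgroup.centralizer ({γ} : Set (archLocal L N (Matrix.diagonal α) w)) := by
    rintro γ ⟨z, hz, rfl⟩
    exact (centralizer_circleDiagonal_eq_subgroupOf L N α w hα hz).symm
  have hcomm : ∀ γ : archLocal L N (Matrix.diagonal α) w,
      (∃ z : Fin N → Circle, Function.Injective z ∧ γ = ⟨circleDiagonal N z, circleDiagonal_mem_archLocal_diagonal L N α w z⟩) →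
        ∀ a ∈ Subgroup.centralizer ({γ} : Set (archLocal L N (Matrix.diagonal α) w)),
          ∀ b ∈ Subgroup.centralizer ({γ} : Set (archLocal L N (Matrix.diagonal α) w)), a * b = b * a := by
    rintro γ ⟨z, hz, rfl⟩ a ha b hb
    exact congrArg Subtype.val (centralizer_circleDiagonal_mul_comm L N α w hα hz ⟨a, ha⟩ ⟨b, hb⟩)
  obtain ⟨t, m, ht, hm⟩ := exists_isQuotientOf_of_torusHaar ν _ tT _ hP hcomm
  refine ⟨t, m, fun z hz => ?_, hm⟩
  exact ht _ ⟨z, hz, rfl⟩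

end UnitaryGroup

end Literature.NumberTheory.Automorphic

end
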